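import Mathlib
import HarnessLib
import Summits.CriticalPhenomena.SAWScalingLimit.Theses.SAWTowerCount
import Summits.CriticalPhenomena.SAWScalingLimit.Theorems.SAWTowerCountSpectralPinKac
import Summits.CriticalPhenomena.SAWScalingLimit.Theorems.SAWTowerCountSpectralPinBounds
import Summits.CriticalPhenomena.SAWScalingLimit.Theorems.SAWTowerCountSpectralPinCore
import Summits.CriticalPhenomena.SAWScalingLimit.Theorems.SAWTowerCountSpectralPinLattice

/-!
# SpectralPin with a uniform level-1 gap: `LevelTwoSolitude⁺ ∧ CorridorCovariance ⇒ b = 5/8 ⇒ X₀`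
(route `SAWTowerCount`, support item stmt-CriticalPhenomena-7259 `SpectralPin`; `--supports`).

`SpectralPin` as filed (`KacRankPin → PoissonKernelExpansion → LevelTwoSolitude → CorridorCovariance
→ CorridorMassFiveEighths`) is not derivable: the typed `LevelTwoSolitude` bounds everything
RELATIVE to its own top term `u₀(i)u₀(j)λ₀^ℓ` and never separates `λ₁, λ₂, …` from `λ₀` uniformly
in `n`, so a cancelling partner (`e₁ = −1`, `λ₁ = λ₀e^{−ε_n/n}`, `ε_n → 0`) hides the named terms in
every scaling window while the tail allowance carries the whole scaling function — for EVERY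
exponent `b` (item evidence `SpectralPin-misstated.md`, two explicit fake families).

This file proves the REPAIRED glue: with ONE extra clause in `LevelTwoSolitude` — a uniform level-1
gap `k ≠ 0 → λ_k ≤ λ₀ e^{−θπ/n}` for some fixed `θ ∈ (0, 5/4]` (recommended `θ = 1/2`: "the level-1
window starts at scaled gap 1/2"; the card's `w ≤ 9` spectra have their first gap at `0.72–0.87`) — `PoissonKernelExpansion`, the gapped
`LevelTwoSolitude` and `CorridorCovariance` imply `CorridorMassFiveEighths`
(`corridorMassFiveEighths_of_levelOneGap`; `spectralPin_of_levelOneGap` has `SpectralPin`'s exact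
shape with the gapped hypothesis).  `KacRankPin` is not needed: the 2×2 minor of the level-2 kernel
at the rows `{1/2, 1/3}` is `b²(8b−5)` by direct evaluation (`…SpectralPinKac`).

Proof (exponential fitting, Steps 0–9 of the evidence note): a priori bounds on the scaled top
rate `ψ_n = −n log λ₀` and on `A(n)u₀u₀` from the gap (`…Bounds`), limits along an ultrafilter
(`…Core`), termwise identification of the two exponential expansions of `m ↦ H_m(y,y')^b` below the
rate `min((b+9/4)π,(b+3)π)` (`…Core`, `…ExpSum`): `ψ* = bπ`, the continuum level-2 kernel
`(2 sin πy sin πy′)^b K₂(y,y′)` is the limit of the unique window term's rank-one kernel, hence has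
vanishing 2×2 minor on `{1/2,1/3}²`, hence `b = 5/8`; then `CorridorCovariance`'s own `(A, b)`
witness `CorridorMassFiveEighths`.  Mathlib + the route file only; no cited facts.
-/

noncomputable section

namespace Summit.CriticalPhenomena.SAWScalingLimit.Theorems.SpectralPin

open Filter Topology Finset

/-- The main term of `PoissonKernelExpansion`, reshaped as `κ·(e^{−bπm} + K₁e^{−(b+1)πm} + K₂e^{−(b+2)πm})`
with `κ = (2 sin πy sin πy′)^b`. -/
theorem pke_reshape (b m s s' K₁ K₂ : ℝ) (hs : 0 ≤ s) (hs' : 0 ≤ s') :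
    (2 * Real.exp (-Real.pi * m) * s * s') ^ b *
        (1 + K₁ * Real.exp (-Real.pi * m) + K₂ * Real.exp (-2 * Real.pi * m)) =
      (2 * s * s') ^ b * (Real.exp (-(b * Real.pi * m)) + K₁ * Real.exp (-((b + 1) * Real.pi * m)) +
        K₂ * Real.exp (-((b + 2) * Real.pi * m))) := by
  have h1 : (2 * Real.exp (-Real.pi * m) * s * s') ^ b =
      Real.exp (-(b * Real.pi * m)) * (2 * s * s') ^ b := by
    rw [show 2 * Real.exp (-Real.pi * m) * s * s' = Real.exp (-Real.pi * m) * (2 * s * s') by ring,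
      Real.mul_rpow (Real.exp_pos _).le (by positivity), ← Real.exp_mul]
    congr 2; ring
  have h2 : Real.exp (-((b + 1) * Real.pi * m)) =
      Real.exp (-(b * Real.pi * m)) * Real.exp (-Real.pi * m) := by
    rw [← Real.exp_add]; congr 1; ring
  have h3 : Real.exp (-((b + 2) * Real.pi * m)) =
      Real.exp (-(b * Real.pi * m)) * Real.exp (-2 * Real.pi * m) := by
    rw [← Real.exp_add]; congr 1; ring
  rw [h1, h2, h3]; ring

/-- **The pin, abstract in `Z` and `H`.** For ANY lattice function `Z` and continuum kernel `H`:
the `PoissonKernelExpansion`-conclusion for `H^b` (bulk rows `η = 1/4`), the gapped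
`LevelTwoSolitude`-conclusion for `Z` (same `η`), and the `CorridorCovariance` window convergence
`A(n)Z_n(⌊mn⌋;⌊yn⌋,⌊y′n⌋) → H_m(y,y′)^b` force `b = 5/8`. -/
theorem pin_abstract (Z : ℕ → ℕ → ℤ → ℤ → ℝ) (H : ℝ → ℝ → ℝ → ℝ) (b : ℝ) (hb : 0 < b)
    (A : ℕ → ℝ) (hApos : ∀ n, 0 < A n) (η : ℝ) (hη : η = 1 / 4) (θ : ℝ) (hθ : 0 < θ) (hθ' : θ ≤ 5 / 4)
    (K₁f K₂f : ℝ → ℝ → ℝ)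
    (hK₂ : ∀ y y' : ℝ, K₂f y y' = b * (3 * (4 * Real.cos (Real.pi * y) ^ 2 - 1) *
      (4 * Real.cos (Real.pi * y') ^ 2 - 1) + 1) +
      32 * b * (b - 1) * Real.cos (Real.pi * y) ^ 2 * Real.cos (Real.pi * y') ^ 2)
    (hPKE : ∃ C m₀ : ℝ, ∀ m y y' : ℝ, m₀ ≤ m → η ≤ y → y ≤ 1 - η → η ≤ y' → y' ≤ 1 - η →
      |H m y y' ^ b - (2 * Real.exp (-Real.pi * m) * Real.sin (Real.pi * y) * Real.sin (Real.pi * y')) ^ b *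
        (1 + K₁f y y' * Real.exp (-Real.pi * m) + K₂f y y' * Real.exp (-2 * Real.pi * m))| ≤
        C * Real.exp (-(b + 3) * Real.pi * m))
    (hLTS : ∃ (C₀ : ℝ) (Kmax n₀ : ℕ), ∀ n : ℕ, n₀ ≤ n → ∃ (K : ℕ) (lam e : ℕ → ℝ) (u : ℕ → ℤ → ℝ),
      K ≤ Kmax ∧ e 0 = 1 ∧
      (∀ k ≤ K, 0 < lam k ∧ e k ^ 2 = 1 ∧ lam k ≤ lam 0 ∧
        lam 0 * Real.exp (-(9 / 4) * Real.pi / n) < lam k ∧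
        (k ≠ 0 → lam k ≤ lam 0 * Real.exp (-θ * Real.pi / n))) ∧
      (∀ k ≤ K, ∀ k' ≤ K, k ≠ k' → lam k ≠ lam k') ∧
      (∃! k : ℕ, k ≤ K ∧ lam k < lam 0 * Real.exp (-(5 / 4) * Real.pi / n)) ∧
      ∀ i j : ℤ, η * n ≤ i → i ≤ (1 - η) * n → η * n ≤ j → j ≤ (1 - η) * n →
        0 < u 0 i ∧ (∀ k ≤ K, |u k i * u k j| ≤ C₀ * (u 0 i * u 0 j)) ∧
        ∀ ℓ : ℕ, n ≤ ℓ → |Z n ℓ i j - ∑ k ∈ Finset.range (K + 1), e k * u k i * u k j * lam k ^ ℓ| ≤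
          C₀ * (u 0 i * u 0 j) * (lam 0 * Real.exp (-(9 / 4) * Real.pi / n)) ^ ℓ)
    (hcv : ∀ ε m₀ m₁ η : ℝ, 0 < ε → 0 < m₀ → m₀ ≤ m₁ → 0 < η → ∃ N : ℕ, ∀ n : ℕ, N ≤ n →
      ∀ m y y' : ℝ, m₀ ≤ m → m ≤ m₁ → η ≤ y → y ≤ 1 - η → η ≤ y' → y' ≤ 1 - η →
        |A n * Z n ⌊m * n⌋₊ ⌊y * n⌋ ⌊y' * n⌋ - H m y y' ^ b| ≤ ε) :
    b = 5 / 8 := by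
  subst hη
  obtain ⟨C_P, m_P, hP⟩ := hPKE
  obtain ⟨C₀, Kmax, n₀, hL⟩ := hLTS
  -- choice functions for the per-`n` data (junk below `n₀`)
  have hL' : ∀ n : ℕ, ∃ (K : ℕ) (lam e : ℕ → ℝ) (u : ℕ → ℤ → ℝ) (k₂ : ℕ), n₀ ≤ n →
      K ≤ Kmax ∧ e 0 = 1 ∧
      (∀ k ≤ K, 0 < lam k ∧ e k ^ 2 = 1 ∧ lam k ≤ lam 0 ∧
        lam 0 * Real.exp (-(9 / 4) * Real.pi / n) < lam k ∧
        (k ≠ 0 → lam k ≤ lam 0 * Real.exp (-θ * Real.pi / n))) ∧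
      (k₂ ≤ K ∧ ∀ k ≤ K, k ≠ k₂ → lam 0 * Real.exp (-(5 / 4) * Real.pi / n) ≤ lam k) ∧
      ∀ i j : ℤ, 1 / 4 * (n : ℝ) ≤ i → (i : ℝ) ≤ (1 - 1 / 4) * n → 1 / 4 * (n : ℝ) ≤ j →
        (j : ℝ) ≤ (1 - 1 / 4) * n →
        0 < u 0 i ∧ (∀ k ≤ K, |u k i * u k j| ≤ C₀ * (u 0 i * u 0 j)) ∧
        ∀ ℓ : ℕ, n ≤ ℓ → |Z n ℓ i j - ∑ k ∈ Finset.range (K + 1), e k * u k i * u k j * lam k ^ ℓ| ≤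
          C₀ * (u 0 i * u 0 j) * (lam 0 * Real.exp (-(9 / 4) * Real.pi / n)) ^ ℓ := by
    intro n
    by_cases hn : n₀ ≤ n
    · obtain ⟨K, lam, e, u, hK, he0, hlam, -, ⟨k₂, hk₂, huniq⟩, hrows⟩ := hL n hn
      refine ⟨K, lam, e, u, k₂, fun _ => ⟨hK, he0, hlam, ⟨hk₂.1, fun k hk hne => ?_⟩, hrows⟩⟩
      by_contra hlt
      push Not at hlt
      exact hne (huniq k ⟨hk, hlt⟩)
    · exact ⟨0, 0, 0, 0, 0, fun h => absurd h hn⟩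
  choose K lam e u k₂ hspec using hL'
  -- the two bulk rows
  set y : Fin 2 → ℝ := ![1 / 2, 1 / 3] with hy
  have hyb : ∀ p, 1 / 3 ≤ y p ∧ y p ≤ 1 / 2 := by
    intro p; fin_cases p <;> simp [hy] <;> norm_num
  have hsin : ∀ p, 0 < Real.sin (Real.pi * y p) := by
    intro p
    have h1 := (hyb p).1; have h2 := (hyb p).2
    refine Real.sin_pos_of_pos_of_lt_pi (by positivity) ?_
    nlinarith [Real.pi_pos]
  -- the sequences
  set n₁ : ℕ := max n₀ 12 with hn₁
  let i : ℕ → Fin 2 → ℤ := fun n p => ⌊y p * n⌋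
  let ψ : ℕ → ℝ := fun n => -(n : ℝ) * Real.log (lam n 0)
  let g : ℕ → ℕ → ℝ := fun n k =>
    if k ≤ K n then (n : ℝ) * (Real.log (lam n 0) - Real.log (lam n k)) else θ * Real.pi
  let a : ℕ → Fin 2 → Fin 2 → ℝ := fun n p q => A n * u n 0 (i n p) * u n 0 (i n q)
  let c : ℕ → ℕ → Fin 2 → Fin 2 → ℝ := fun n k p q =>
    if k ≤ K n then e n k * u n k (i n p) * u n k (i n q) / (u n 0 (i n p) * u n 0 (i n q)) else 0
  let τ : ℕ → ℝ → ℝ := fun n m => ((⌊m * n⌋₊ : ℕ) : ℝ) / n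
  let f : ℕ → Fin 2 → Fin 2 → ℝ → ℝ := fun n p q m => A n * Z n ⌊m * n⌋₊ (i n p) (i n q)
  let Φ : Fin 2 → Fin 2 → ℝ → ℝ := fun p q m => H m (y p) (y q) ^ b
  let κ : Fin 2 → Fin 2 → ℝ := fun p q => (2 * Real.sin (Real.pi * y p) * Real.sin (Real.pi * y q)) ^ b
  let K₁s : Fin 2 → Fin 2 → ℝ := fun p q => K₁f (y p) (y q)
  let K₂s : Fin 2 → Fin 2 → ℝ := fun p q => K₂f (y p) (y q)
  let kw : ℕ → ℕ := fun n => min (k₂ n) Kmax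
  -- bookkeeping for `n ≥ n₁`
  have hn₁₀ : ∀ n, n₁ ≤ n → n₀ ≤ n := fun n hn => le_trans (le_max_left _ _) hn
  have hn₁₂ : ∀ n, n₁ ≤ n → 12 ≤ n := fun n hn => le_trans (le_max_right _ _) hn
  have hn1 : ∀ n, n₁ ≤ n → 1 ≤ n := fun n hn => le_trans (by norm_num) (hn₁₂ n hn)
  have hnpos : ∀ n, n₁ ≤ n → (0 : ℝ) < n := fun n hn => by
    have := hn1 n hn; exact_mod_cast this
  have hrow : ∀ n, n₁ ≤ n → ∀ p, 1 / 4 * (n : ℝ) ≤ (i n p : ℝ) ∧ ((i n p : ℤ) : ℝ) ≤ (1 - 1 / 4) * n :=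
    fun n hn p => floor_row_mem (hyb p).1 (hyb p).2 (hn₁₂ n hn)
  have hS := fun n (hn : n₁ ≤ n) => hspec n (hn₁₀ n hn)
  have hKle : ∀ n, n₁ ≤ n → K n ≤ Kmax := fun n hn => (hS n hn).1
  have he0 : ∀ n, n₁ ≤ n → e n 0 = 1 := fun n hn => (hS n hn).2.1
  have hlam : ∀ n, n₁ ≤ n → ∀ k ≤ K n, 0 < lam n k ∧ e n k ^ 2 = 1 ∧ lam n k ≤ lam n 0 ∧
      lam n 0 * Real.exp (-(9 / 4) * Real.pi / n) < lam n k ∧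
      (k ≠ 0 → lam n k ≤ lam n 0 * Real.exp (-θ * Real.pi / n)) :=
    fun n hn => (hS n hn).2.2.1
  have hk₂K : ∀ n, n₁ ≤ n → k₂ n ≤ K n := fun n hn => (hS n hn).2.2.2.1.1
  have hwin0 : ∀ n, n₁ ≤ n → ∀ k ≤ K n, k ≠ k₂ n →
      lam n 0 * Real.exp (-(5 / 4) * Real.pi / n) ≤ lam n k := fun n hn => (hS n hn).2.2.2.1.2
  have hR : ∀ n, n₁ ≤ n → ∀ p q, 0 < u n 0 (i n p) ∧
      (∀ k ≤ K n, |u n k (i n p) * u n k (i n q)| ≤ C₀ * (u n 0 (i n p) * u n 0 (i n q))) ∧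
      ∀ ℓ : ℕ, n ≤ ℓ → |Z n ℓ (i n p) (i n q) -
        ∑ k ∈ Finset.range (K n + 1), e n k * u n k (i n p) * u n k (i n q) * lam n k ^ ℓ| ≤
        C₀ * (u n 0 (i n p) * u n 0 (i n q)) * (lam n 0 * Real.exp (-(9 / 4) * Real.pi / n)) ^ ℓ :=
    fun n hn p q => (hS n hn).2.2.2.2 (i n p) (i n q) (hrow n hn p).1 (hrow n hn p).2
      (hrow n hn q).1 (hrow n hn q).2
  have hu0 : ∀ n, n₁ ≤ n → ∀ p, 0 < u n 0 (i n p) := fun n hn p => (hR n hn p p).1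
  have hkw : ∀ n, n₁ ≤ n → kw n = k₂ n := fun n hn =>
    min_eq_left (le_trans (hk₂K n hn) (hKle n hn))
  have hC₀ : 0 ≤ C₀ := by
    have h := (hR n₁ le_rfl 0 0).2.1 0 (Nat.zero_le _)
    have hpos : 0 < u n₁ 0 (i n₁ 0) * u n₁ 0 (i n₁ 0) := mul_pos (hu0 n₁ le_rfl 0) (hu0 n₁ le_rfl 0)
    have := (abs_nonneg _).trans h
    nlinarith
  -- the abstract hypotheses
  have hκ : ∀ p q, 0 < κ p q := fun p q =>
    Real.rpow_pos_of_pos (mul_pos (mul_pos two_pos (hsin p)) (hsin q)) b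
  have hPKEs : ∀ p q, ∀ m : ℝ, m_P ≤ m →
      |Φ p q m - κ p q * (Real.exp (-(b * Real.pi * m)) + K₁s p q * Real.exp (-((b + 1) * Real.pi * m)) +
        K₂s p q * Real.exp (-((b + 2) * Real.pi * m)))| ≤ C_P * Real.exp (-((b + 3) * Real.pi * m)) := by
    intro p q m hm
    have h := hP m (y p) (y q) hm (by linarith [(hyb p).1]) (by linarith [(hyb p).2])
      (by linarith [(hyb q).1]) (by linarith [(hyb q).2])
    rw [pke_reshape b m _ _ _ _ (hsin p).le (hsin q).le,
      show -(b + 3) * Real.pi * m = -((b + 3) * Real.pi * m) by ring] at h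
    exact h
  have hg0 : ∀ n, g n 0 = 0 := fun n => by simp [g]
  have hθπ : 0 < θ * Real.pi := mul_pos hθ Real.pi_pos
  have hgap : ∀ n, n₁ ≤ n → ∀ k, 1 ≤ k → θ * Real.pi ≤ g n k := by
    intro n hn k hk
    by_cases hkK : k ≤ K n
    · have h := (hlam n hn k hkK)
      have hle := h.2.2.2.2 (Nat.one_le_iff_ne_zero.mp hk)
      have := le_rate_of_le (hnpos n hn) h.1 hle
      simp only [g, if_pos hkK]
      linarith
    · simp only [g, if_neg hkK]; exact le_rfl
  have hgb : ∀ n, n₁ ≤ n → ∀ k, 0 ≤ g n k ∧ g n k ≤ 9 / 4 * Real.pi := by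
    intro n hn k
    by_cases hkK : k ≤ K n
    · have h := hlam n hn k hkK
      have h0 := (hlam n hn 0 (Nat.zero_le _)).1
      simp only [g, if_pos hkK]
      exact ⟨rate_nonneg (hnpos n hn) h.1 h.2.2.1, (rate_lt_of_lt (hnpos n hn) h0 h.2.2.2.1).le⟩
    · simp only [g, if_neg hkK]
      constructor <;> nlinarith [Real.pi_pos]
  have hwin : ∀ n, n₁ ≤ n → ∀ k, k ≠ kw n → g n k ≤ 5 / 4 * Real.pi := by
    intro n hn k hk
    rw [hkw n hn] at hk
    by_cases hkK : k ≤ K n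
    · have h0 := (hlam n hn 0 (Nat.zero_le _)).1
      simp only [g, if_pos hkK]
      exact rate_le_of_le (hnpos n hn) h0 (hwin0 n hn k hkK hk)
    · simp only [g, if_neg hkK]; nlinarith [Real.pi_pos]
  have hkwle : ∀ n, kw n ≤ Kmax := fun n => min_le_right _ _
  have hc0 : ∀ n, n₁ ≤ n → ∀ p q, c n 0 p q = 1 := by
    intro n hn p q
    have hpos : u n 0 (i n p) * u n 0 (i n q) ≠ 0 := (mul_pos (hu0 n hn p) (hu0 n hn q)).ne'
    simp only [c, if_pos (Nat.zero_le _), he0 n hn, one_mul]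
    exact div_self hpos
  have hcb : ∀ n, n₁ ≤ n → ∀ k p q, |c n k p q| ≤ C₀ := by
    intro n hn k p q
    by_cases hkK : k ≤ K n
    · simp only [c, if_pos hkK]
      exact abs_coeff_le _ _ _ _ _ _ (hlam n hn k hkK).2.1 (mul_pos (hu0 n hn p) (hu0 n hn q))
        ((hR n hn p q).2.1 k hkK)
    · simp only [c, if_neg hkK, abs_zero]; exact hC₀
  have hapos : ∀ n, n₁ ≤ n → ∀ p q, 0 < a n p q := fun n hn p q =>
    mul_pos (mul_pos (hApos n) (hu0 n hn p)) (hu0 n hn q)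
  have hτint : ∀ n, n₁ ≤ n → ∀ j : ℕ, τ n j = j := fun n hn j =>
    natFloor_natCast_mul_div (hn1 n hn) j
  have hτ : ∀ m : ℝ, 1 ≤ m → Tendsto (fun n => τ n m) atTop (𝓝 m) := fun m hm =>
    tendsto_natFloor_mul_div (by linarith)
  have hrep : ∀ n, n₁ ≤ n → ∀ p q, ∀ m : ℝ, 1 ≤ m →
      |f n p q m - a n p q * ∑ k ∈ Finset.range (Kmax + 1),
          c n k p q * Real.exp (-((ψ n + g n k) * τ n m))| ≤
        C₀ * a n p q * Real.exp (-((ψ n + 9 / 4 * Real.pi) * τ n m)) := by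
    intro n hn p q m hm
    have h := (hR n hn p q).2.2 ⌊m * n⌋₊ (le_natFloor_mul hm n)
    exact rep_conv n ⌊m * n⌋₊ (K n) Kmax (hnpos n hn) (hKle n hn) (A n) C₀ _ (θ * Real.pi) (hApos n)
      (lam n) (e n)
      (fun k => u n k (i n p)) (fun k => u n k (i n q)) (fun k hk => (hlam n hn k hk).1)
      (hu0 n hn p) (hu0 n hn q) h
  have hconv : ∀ p q, ∀ m : ℝ, 1 ≤ m → Tendsto (fun n => f n p q m) atTop (𝓝 (Φ p q m)) := by
    intro p q m hm
    rw [Metric.tendsto_atTop]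
    intro ε hε
    obtain ⟨N, hN⟩ := hcv (ε / 2) m m (1 / 4) (half_pos hε) (by linarith) le_rfl (by norm_num)
    refine ⟨N, fun n hn => ?_⟩
    have h := hN n hn m (y p) (y q) le_rfl le_rfl (by linarith [(hyb p).1]) (by linarith [(hyb p).2])
      (by linarith [(hyb q).1]) (by linarith [(hyb q).2])
    rw [Real.dist_eq]
    exact lt_of_le_of_lt h (half_lt_self hε)
  have hrank : ∀ n, n₁ ≤ n → (a n 0 0 * c n (kw n) 0 0) * (a n 1 1 * c n (kw n) 1 1) =
      (a n 0 1 * c n (kw n) 0 1) * (a n 1 0 * c n (kw n) 1 0) := by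
    intro n hn
    have hk : kw n ≤ K n := (hkw n hn).symm ▸ hk₂K n hn
    have key : ∀ p q, a n p q * c n (kw n) p q =
        A n * e n (kw n) * u n (kw n) (i n p) * u n (kw n) (i n q) := fun p q => by
      simp only [a, c, if_pos hk]
      exact ac_eq _ _ _ _ _ _ (mul_pos (hu0 n hn p) (hu0 n hn q)).ne'
    rw [key, key, key, key]; ring
  -- Step 3: a priori bounds
  obtain ⟨n₂, ψlo, ψhi, alo, ahi, halo, hbd⟩ := apriori_bounds b κ K₁s K₂s C_P m_P hκ Φ hPKEs Kmax C₀
    (θ * Real.pi) hθπ (by nlinarith [Real.pi_pos]) ψ g a c τ f n₁ hg0 hgap hc0 hcb hapos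
    hτint hrep hconv
  -- Steps 4–7: limits and the static core, from `n₃ = max n₁ n₂` on
  set n₃ : ℕ := max n₁ n₂ with hn₃
  have h31 : ∀ n, n₃ ≤ n → n₁ ≤ n := fun n hn => le_trans (le_max_left _ _) hn
  have h32 : ∀ n, n₃ ≤ n → n₂ ≤ n := fun n hn => le_trans (le_max_right _ _) hn
  have hminor := levelTwo_minor_of_sequences b (θ * Real.pi) hθπ κ K₁s K₂s C_P m_P hκ Φ
    hPKEs Kmax C₀ kw hkwle ψ g a c τ hτ f ψlo ψhi alo ahi halo n₃ hg0
    (fun n hn => hgb n (h31 n hn)) (fun n hn => hgap n (h31 n hn)) (fun n hn => hwin n (h31 n hn))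
    (fun n hn => hc0 n (h31 n hn)) (fun n hn => hcb n (h31 n hn))
    (fun n hn => (hbd n (h32 n hn)).1) (fun n hn => (hbd n (h32 n hn)).2)
    (fun n hn => hrank n (h31 n hn)) (fun n hn => hrep n (h31 n hn)) hconv
  -- Step 8: the Kac pin at the rows `{1/2, 1/3}`
  refine b_eq_five_eighths_of_weighted_minor b hb K₂f
    (fun y y' => (2 * Real.sin (Real.pi * y) * Real.sin (Real.pi * y')) ^ b * K₂f y y') hK₂
    (fun _ _ => rfl) ?_
  simpa [κ, K₂s, hy] using hminor

-- The route file elaborates its inlined `let Z := …` under `open scoped Classical`; the gapped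
-- hypothesis below must produce the same `DecidablePred` instances to be the same term.
open scoped Classical in
/-- **Repaired SpectralPin (route decls).** For any fixed scaled gap `θ ∈ (0, 5/4]`:
`PoissonKernelExpansion`, the GAPPED `LevelTwoSolitude` (verbatim stmt-CriticalPhenomena-7253 plus
the clause `k ≠ 0 → lam k ≤ lam 0 · e^{−θπ/n}` inside `∀ k ≤ K`; recommended restatement `θ = 1/2`)
and `CorridorCovariance` imply `CorridorMassFiveEighths`. -/
theorem corridorMassFiveEighths_of_levelOneGap (θ : ℝ) (hθ : 0 < θ) (hθ' : θ ≤ 5 / 4)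
    (hPKE : Summit.CriticalPhenomena.SAWScalingLimit.Theses.SAWTowerCount.PoissonKernelExpansion)
    (hLTS : let Z : ℕ → ℕ → ℤ → ℤ → ℝ := fun n ℓ i j => ∑ s ∈ Finset.range ((ℓ + 1) * n + 1), Literature.Probability.RandomPlanarGeometry.SAW.criticalFugacity ^ s * ((((Literature.Probability.LatticeModels.zdGraph 2).finsetWalkLength s (![0, i] : Literature.Probability.LatticeModels.Site 2) ![(ℓ : ℤ), j]).filter (fun p => p.IsPath ∧ ∀ v ∈ p.support, 0 ≤ v 0 ∧ v 0 ≤ (ℓ : ℤ) ∧ 1 ≤ v 1 ∧ v 1 ≤ (n : ℤ))).card : ℝ); ∀ η : ℝ, 0 < η → ∃ (C₀ : ℝ) (Kmax n₀ : ℕ), ∀ n : ℕ, n₀ ≤ n → ∃ (K : ℕ) (lam e : ℕ → ℝ) (u : ℕ → ℤ → ℝ), K ≤ Kmax ∧ e 0 = 1 ∧ (∀ k ≤ K, 0 < lam k ∧ e k ^ 2 = 1 ∧ lam k ≤ lam 0 ∧ lam 0 * Real.exp (-(9 / 4) * Real.pi / n) < lam k ∧ (k ≠ 0 → lam k ≤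 lam 0 * Real.exp (-θ * Real.pi / n))) ∧ (∀ k ≤ K, ∀ k' ≤ K, k ≠ k' → lam k ≠ lam k') ∧ (∃! k : ℕ, k ≤ K ∧ lam k < lam 0 * Real.exp (-(5 / 4) * Real.pi / n)) ∧ ∀ i j : ℤ, η * n ≤ i → i ≤ (1 - η) * n → η * n ≤ j → j ≤ (1 - η) * n → 0 < u 0 i ∧ (∀ k ≤ K, |u k i * u k j| ≤ C₀ * (u 0 i * u 0 j)) ∧ ∀ ℓ : ℕ, n ≤ ℓ → |Z n ℓ i j - ∑ k ∈ Finset.range (K + 1), e k * u k i * u k j * lam k ^ ℓ| ≤ C₀ * (u 0 i * u 0 j) * (lam 0 * Real.exp (-(9 / 4) * Real.pi / n)) ^ ℓ)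
    (hCC : Summit.CriticalPhenomena.SAWScalingLimit.Theses.SAWTowerCount.CorridorCovariance) :
    Summit.CriticalPhenomena.SAWScalingLimit.Theses.SAWTowerCount.CorridorMassFiveEighths := by
  unfold Summit.CriticalPhenomena.SAWScalingLimit.Theses.SAWTowerCount.CorridorCovariance at hCC
  unfold Summit.CriticalPhenomena.SAWScalingLimit.Theses.SAWTowerCount.CorridorMassFiveEighths
  unfold Summit.CriticalPhenomena.SAWScalingLimit.Theses.SAWTowerCount.PoissonKernelExpansion at hPKE
  dsimp only at hCC hLTS hPKE ⊢
  obtain ⟨b, hb, A, hApos, hArv, hcv⟩ := hCC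
  have hb58 : b = 5 / 8 :=
    pin_abstract _ _ b hb A hApos (1 / 4) rfl θ hθ hθ' _ _ (fun _ _ => rfl)
      (hPKE b (1 / 4) hb (by norm_num) (by norm_num)) (hLTS (1 / 4) (by norm_num)) hcv
  subst hb58
  refine ⟨A, hApos, fun t ht ht1 => ?_, hcv⟩
  have := hArv t ht ht1
  norm_num at this
  exact this

open scoped Classical in
/-- **Repaired SpectralPin in `SpectralPin`'s own shape** (`KacRankPin` is carried but not used). -/
theorem spectralPin_of_levelOneGap (θ : ℝ) (hθ : 0 < θ) (hθ' : θ ≤ 5 / 4)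
    (hKRP : Summit.CriticalPhenomena.SAWScalingLimit.Theses.SAWTowerCount.KacRankPin)
    (hPKE : Summit.CriticalPhenomena.SAWScalingLimit.Theses.SAWTowerCount.PoissonKernelExpansion)
    (hLTS : let Z : ℕ → ℕ → ℤ → ℤ → ℝ := fun n ℓ i j => ∑ s ∈ Finset.range ((ℓ + 1) * n + 1), Literature.Probability.RandomPlanarGeometry.SAW.criticalFugacity ^ s * ((((Literature.Probability.LatticeModels.zdGraph 2).finsetWalkLength s (![0, i] : Literature.Probability.LatticeModels.Site 2) ![(ℓ : ℤ), j]).filter (fun p => p.IsPath ∧ ∀ v ∈ p.support, 0 ≤ v 0 ∧ v 0 ≤ (ℓ : ℤ) ∧ 1 ≤ v 1 ∧ v 1 ≤ (n : ℤ))).card : ℝ); ∀ η : ℝ, 0 < η → ∃ (C₀ : ℝ) (Kmax n₀ : ℕ), ∀ n : ℕ, n₀ ≤ n → ∃ (K : ℕ) (lam e : ℕ → ℝ) (u : ℕ → ℤ → ℝ), K ≤ Kmax ∧ e 0 = 1 ∧ (∀ k ≤ K, 0 < lam k ∧ e k ^ 2 = 1 ∧ lam k ≤ lam 0 ∧ lam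 0 * Real.exp (-(9 / 4) * Real.pi / n) < lam k ∧ (k ≠ 0 → lam k ≤ lam 0 * Real.exp (-θ * Real.pi / n))) ∧ (∀ k ≤ K, ∀ k' ≤ K, k ≠ k' → lam k ≠ lam k') ∧ (∃! k : ℕ, k ≤ K ∧ lam k < lam 0 * Real.exp (-(5 / 4) * Real.pi / n)) ∧ ∀ i j : ℤ, η * n ≤ i → i ≤ (1 - η) * n → η * n ≤ j → j ≤ (1 - η) * n → 0 < u 0 i ∧ (∀ k ≤ K, |u k i * u k j| ≤ C₀ * (u 0 i * u 0 j)) ∧ ∀ ℓ : ℕ, n ≤ ℓ → |Z n ℓ i j - ∑ k ∈ Finset.range (K + 1), e k * u k i * u k j * lam k ^ ℓ| ≤ C₀ * (u 0 i * u 0 j) * (lam 0 * Real.exp (-(9 / 4) * Real.pi / n)) ^ ℓ)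
    (hCC : Summit.CriticalPhenomena.SAWScalingLimit.Theses.SAWTowerCount.CorridorCovariance) :
    Summit.CriticalPhenomena.SAWScalingLimit.Theses.SAWTowerCount.CorridorMassFiveEighths :=
  have _ := hKRP
  corridorMassFiveEighths_of_levelOneGap θ hθ hθ' hPKE hLTS hCC

end Summit.CriticalPhenomena.SAWScalingLimit.Theorems.SpectralPin
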